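import Summits.AnomalousDissipation.AnomalousDissipation.Theses.NeutralTaylorWaves

/-!
# Sketch — first lemmas of two crux-idea lines for `NewtonRealisation`
(stmt-AnomalousDissipation-16315, route NeutralTaylorWaves; crux-ideate round 1, ideator 2)

Only SIGNATURES (as `Prop`-valued definitions) — nothing is proved here; the file must elaborate.

* `BorderedFredholmCore`      — abstract core of line A (lattice-fredholm-persistence): a bordered
                                compact perturbation of `c·1` with trivial bordered kernel is a
                                linear homeomorphism of `E × ℝ` (Mathlib only).
* `InverseBoundByDensity`     — abstract core of line A: the inverse norm is read off a dense set.
* `BorderedGraphBound`        — the shared quantitative `H²`-graph bound (physical vocabulary): the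
                                crux's bordered `L²` a-priori bound + ONE elliptic absorption using
                                only `sup|w| ≤ C`, `sup|∂w| ≤ Cν⁻¹` ⇒ loss exponent `K₀ + 2`.
* `InfSupDescent`             — abstract core of line B (galerkin-infsup-descent): an injectivity
                                modulus for `c·1 + K` descends to the ranges of projections `P_N`
                                once `‖(1 − P_N) K‖ ≤ R/(N+1)` (the `H¹`-gain of `K`).
* `QuantRelativePersistence`  — the common TRANSFER target `C⁺` (fixed viscosity, explicit
                                threshold): quasi-steady drifting state + bordered a-priori bound +
                                small residual ⇒ nearby classical steady state of the SAME force
                                (drift realised as the mean).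
-/

set_option linter.dupNamespace false

noncomputable section

open Filter Set MeasureTheory Topology
open Literature.Analysis.FunctionSpaces Literature.Analysis.FunctionSpaces.Torus

namespace Summit.AnomalousDissipation.AnomalousDissipation.Cruxes.NewtonRealisation.Sketch

local notation "𝕋³" => UnitAddTorus (Fin 3)
local notation "E³" => EuclideanSpace ℝ (Fin 3)

/-- Line A, first lemma (abstract): **bordered Fredholm alternative**. On a real Banach space `E`,
for `K` compact, `c ≠ 0`, a vector `e` and a functional `φ`, if the bordered map
`(x, t) ↦ (c•x + K x − t•e, φ x)` has trivial kernel then it is a linear homeomorphism of `E × ℝ`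
(it is `c•1 + compact` on `E × ℝ`; `SteadyLattice.exists_equiv_of_injective` /
`Literature.Analysis.Calculus.bijective_of_injective_of_isCompactOperator`). -/
def BorderedFredholmCore : Prop :=
  ∀ {E : Type} [NormedAddCommGroup E] [NormedSpace ℝ E] [CompleteSpace E]
    (K : E →L[ℝ] E) (_hK : IsCompactOperator K) (c : ℝ) (_hc : c ≠ 0) (e : E) (φ : E →L[ℝ] ℝ),
    (∀ (x : E) (t : ℝ), c • x + K x - t • e = 0 → φ x = 0 → x = 0 ∧ t = 0) →
    ∃ L : (E × ℝ) ≃L[ℝ] (E × ℝ), ∀ (x : E) (t : ℝ), L (x, t) = (c • x + K x - t • e, φ x)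

/-- Line A, second abstract lemma: **the inverse bound is read off a dense set** (the crux's
a-priori bound is available only on smooth = rapidly-decaying data; continuity of `L⁻¹` and
density of finitely supported lattice families in `SteadyLattice.W` do the rest). -/
def InverseBoundByDensity : Prop :=
  ∀ {E F : Type} [NormedAddCommGroup E] [NormedSpace ℝ E] [NormedAddCommGroup F] [NormedSpace ℝ F]
    (L : E ≃L[ℝ] F) (D : Set F) (M : ℝ), Dense D → 0 ≤ M →
    (∀ y ∈ D, ‖L.symm y‖ ≤ M * ‖y‖) → ‖(L.symm : F →L[ℝ] E)‖ ≤ M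

/-- Shared quantitative lemma (physical vocabulary): **bordered `H²`-graph bound with loss
exponent `K₀ + 2`**. Under the crux's hypotheses on `(w, c)` at viscosity `ν ≤ 1` (only the sup
bounds on `w` and `∂w` are used) every smooth solution `(v, r, b)` of the bordered linearised
steady system with right-hand side `g` obeys
`∫‖v‖² + ‖∇v‖² + ∫‖Δv‖² + b² ≤ (A (1+|C|)² (1 + |C₀|ν^{-K₀}) ν⁻²)² (∫‖g‖² + ⟨v, ∂₃w⟩²)`:
the a-priori bound gives `‖v‖, |b|`; Helmholtz orthogonality `ν²‖Δv‖² ≤ ‖h‖²` for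
`νΔv − ∇r = h`, `‖∇v‖² ≤ ‖v‖‖Δv‖` and one absorption give `‖Δv‖`. -/
def BorderedGraphBound : Prop :=
  ∃ A : ℝ, 0 < A ∧ ∀ (ν C C₀ : ℝ) (K₀ : ℕ) (w : 𝕋³ → E³) (c : ℝ), 0 < ν → ν ≤ 1 →
    IsSmooth w → IsDivFree w → HasZeroMean w → |c| ≤ C → (∀ x, ‖w x‖ ≤ C) →
    (∀ (i : Fin 3) x, ‖Torus.partialDeriv i w x‖ ≤ C * ν⁻¹) →
    (∀ (v : 𝕋³ → E³) (r : 𝕋³ → ℝ) (b : ℝ), IsSmooth v → IsSmooth r → IsDivFree v → HasZeroMean v →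
      MeasureTheory.integral MeasureTheory.volume (fun x => ‖v x‖ ^ 2) + b ^ 2 ≤
        (C₀ * ν⁻¹ ^ K₀) ^ 2 * (MeasureTheory.integral MeasureTheory.volume (fun x =>
          ‖Torus.convect w v x + Torus.convect v w x - ν • Torus.laplacian v x + Torus.gradient r x -
            c • Torus.partialDeriv (2 : Fin 3) v x - b • Torus.partialDeriv (2 : Fin 3) w x‖ ^ 2) +
          (MeasureTheory.integral MeasureTheory.volume (fun x =>
            inner ℝ (v x) (Torus.partialDeriv (2 : Fin 3) w x))) ^ 2)) →
    ∀ (v g : 𝕋³ → E³) (r : 𝕋³ → ℝ) (b : ℝ), IsSmooth v → IsSmooth g → IsSmooth r → IsDivFree v →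
      HasZeroMean v →
      (∀ x, Torus.convect w v x + Torus.convect v w x - ν • Torus.laplacian v x + Torus.gradient r x -
          c • Torus.partialDeriv (2 : Fin 3) v x - b • Torus.partialDeriv (2 : Fin 3) w x = g x) →
      MeasureTheory.integral MeasureTheory.volume (fun x => ‖v x‖ ^ 2) + gradNormSq v +
          MeasureTheory.integral MeasureTheory.volume (fun x => ‖Torus.laplacian v x‖ ^ 2) + b ^ 2 ≤
        (A * (1 + |C|) ^ 2 * (1 + |C₀| * ν⁻¹ ^ K₀) * ν⁻¹ ^ 2) ^ 2 *
          (MeasureTheory.integral MeasureTheory.volume (fun x => ‖g x‖ ^ 2) +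
            (MeasureTheory.integral MeasureTheory.volume (fun x =>
              inner ℝ (v x) (Torus.partialDeriv (2 : Fin 3) w x))) ^ 2)

/-- Line B, first lemma (abstract): **an injectivity modulus descends to truncations**. In a real
normed space with idempotent continuous linear "truncations" `P N`, if `‖x‖ ≤ M ‖c•x + K x‖` for all
`x` and the truncation defect is small ON THE RANGE of `P N`, `‖K x − P N (K x)‖ ≤ R/(N+1) · ‖x‖`
(the `H¹`-gain of the linearised convective operator, `SteadyLattice.eNormSq_one_linearised_le`, +
Chebyshev on the lattice; diagonal pieces — Stokes, drift — have zero defect there), then for `N + 1 ≥ 2 M R` every `x` in the range of `P N` satisfies the DISCRETE bound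
`‖x‖ ≤ 2 M ‖P N (c•x + K x)‖` — the inf-sup datum of
`Literature.Analysis.Calculus.exists_zero_of_infSup_newton`. -/
def InfSupDescent : Prop :=
  ∀ {H : Type} [NormedAddCommGroup H] [NormedSpace ℝ H] (P : ℕ → H →L[ℝ] H) (K : H →L[ℝ] H)
    (c M R : ℝ), 0 ≤ M → 0 ≤ R → (∀ N x, P N (P N x) = P N x) →
    (∀ x, ‖x‖ ≤ M * ‖c • x + K x‖) →
    (∀ N x, P N x = x → ‖K x - P N (K x)‖ ≤ R / (N + 1) * ‖x‖) →
    ∀ N : ℕ, 2 * M * R ≤ N + 1 → ∀ x, P N x = x → ‖x‖ ≤ 2 * M * ‖P N (c • x + K x)‖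

/-- The common TRANSFER target `C⁺` — **quantitative persistence of a relative quasi-steady state at
fixed viscosity**: universal exponents `a, b` and `κ > 0` such that for `0 < ν ≤ 1`, `M ≥ 1`,
`C ≥ 0`, a smooth admissible force `f`, a smooth divergence-free mean-zero `w`, smooth `q`, drift
`|c| ≤ C`, sup bounds `|w| ≤ C`, `|∂ᵢw| ≤ Cν⁻¹`, the bordered `L²` a-priori bound with constant `M`
and residual `‖w·∇w − νΔw + ∇q − c∂₃w − f‖₂ ≤ κ ν^a /((1+C)^b M²)`, there is a time-constant
CLASSICAL solution `(u, p)` of `NS_ν(f)` on `T³ × ℝ` (the drift realised as the mean of `u`) with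
`∫‖u‖² ≤ 2∫‖w‖² + 2(C+2)²` and `|ν‖∇u‖² − ν‖∇w‖²| ≤ ν`. Both lines prove `C⁺`; `C⁺ ⇒ crux` is
selection along the nonresonant subsequence with `K = 2a + 4K₀ + 1`. -/
def QuantRelativePersistence : Prop :=
  ∃ (a b : ℕ) (κ : ℝ), 0 < κ ∧ ∀ (ν M C : ℝ) (f w : 𝕋³ → E³) (q : 𝕋³ → ℝ) (c : ℝ),
    0 < ν → ν ≤ 1 → 1 ≤ M → 0 ≤ C →
    IsSmooth f → IsDivFree f → HasZeroMean f →
    IsSmooth w → IsSmooth q → IsDivFree w → HasZeroMean w → |c| ≤ C → (∀ x, ‖w x‖ ≤ C) →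
    (∀ (i : Fin 3) x, ‖Torus.partialDeriv i w x‖ ≤ C * ν⁻¹) →
    (∀ (v : 𝕋³ → E³) (r : 𝕋³ → ℝ) (b : ℝ), IsSmooth v → IsSmooth r → IsDivFree v → HasZeroMean v →
      MeasureTheory.integral MeasureTheory.volume (fun x => ‖v x‖ ^ 2) + b ^ 2 ≤
        M ^ 2 * (MeasureTheory.integral MeasureTheory.volume (fun x =>
          ‖Torus.convect w v x + Torus.convect v w x - ν • Torus.laplacian v x + Torus.gradient r x -
            c • Torus.partialDeriv (2 : Fin 3) v x - b • Torus.partialDeriv (2 : Fin 3) w x‖ ^ 2) +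
          (MeasureTheory.integral MeasureTheory.volume (fun x =>
            inner ℝ (v x) (Torus.partialDeriv (2 : Fin 3) w x))) ^ 2)) →
    MeasureTheory.integral MeasureTheory.volume (fun x =>
        ‖Torus.convect w w x - ν • Torus.laplacian w x + Torus.gradient q x -
          c • Torus.partialDeriv (2 : Fin 3) w x - f x‖ ^ 2) ≤
      (κ * ν ^ a / ((1 + C) ^ b * M ^ 2)) ^ 2 →
    ∃ (u : 𝕋³ → E³) (p : 𝕋³ → ℝ),
      IsClassicalNSSolutionOn Set.univ ν (fun _ => f) (fun _ => u) (fun _ => p) ∧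
      MeasureTheory.integral MeasureTheory.volume (fun x => ‖u x‖ ^ 2) ≤
        2 * MeasureTheory.integral MeasureTheory.volume (fun x => ‖w x‖ ^ 2) + 2 * (C + 2) ^ 2 ∧
      |ν * gradNormSq u - ν * gradNormSq w| ≤ ν

/-- Wiring check of the transfer direction used by both lines (statement only): `C⁺ ⇒ crux`. -/
def TransferClosesCrux : Prop :=
  QuantRelativePersistence →
    Summit.AnomalousDissipation.AnomalousDissipation.Theses.NeutralTaylorWaves.NewtonRealisation

end Summit.AnomalousDissipation.AnomalousDissipation.Cruxes.NewtonRealisation.Sketch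

end
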